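import Mathlib
import Literature.NumberTheory.LFunctions.Zhang2022.SkeletonPartThree
import Literature.NumberTheory.LFunctions.ZetaRealAxis
import HarnessLib

/-!
# Zhang (2022), §7 part (c): the presupposition of the (7.19) contour move — under (A), `ζ(s) ≠ 0`
# for `σ ≥ 1 − 𝓛⁻¹`, `|t| ≤ D` (Deuring–Heilbronn for the principal character)

Topic `Literature/NumberTheory/LFunctions/Zhang2022` (Landau–Siegel audit tree; verdict-neutral).
Y. Zhang, *Discrete mean estimates and the Landau–Siegel zero*, arXiv:2211.02515v1 (2022)
[Zhang2022LandauSiegel], §7 p. 40 (tex L2108–L2117): "… for `σ > 9/10`, we can move the contour of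
integration in (7.19) to the vertical segments `s = 1 + α + it` with `|t| ≥ D`, `s = 1 − 𝓛⁻¹ + it`
with `|t| ≤ D` and to the two connecting horizontal segments …".

The typed node `Section7dStatements.Step7u047` (p412033) records in its docstring (and the campaign's
gap ledger, row G-adj2-3) that this move presupposes, uncited, that the factor `ζ(s)⁻¹` of the
continued integrand has no pole in the region swept, i.e. **`ζ(s) ≠ 0` for `σ ≥ 1 − 𝓛⁻¹`,
`|t| ≤ D`** — which the classical zero-free region (`σ ≥ 1 − c₀/log(|t|+3)`, `c₀ < 1`) does not
supply. This THEOREM-ONLY file (0 new facts, D-0026) proves that, in the manuscript's own framework —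
Assumption (A), in force from §5 on — the presupposition HOLDS for all sufficiently large `D`:
`zeta_ne_zero_of_assumptionA`. The mechanism is the one the manuscript uses for `L(s,χ)` in
Lemma 5.5 ("a weaker form of the Deuring–Heilbronn phenomenon"), applied to the principal character:
under (A), Lemma 5.5 (tree theorem `Skeleton.lemma55_holds`, via the tree's kernel proof of the
Deuring–Heilbronn phenomenon `deuring_heilbronn_holds`) gives a real zero `ρ̃` of `L(s,χ)` with
`0 < 1 − ρ̃ ≤ C𝓛⁻²⁰²²`; the Deuring–Heilbronn repulsion for the principal character mod `D` (whose
`L`-function is `ζ(s)·∏_{p∣D}(1 − p^{−s})`, Mathlib `LFunctionTrivChar_eq_mul_riemannZeta`) then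
forces every zero `ρ = σ + it` of `ζ` with `0 < σ < 1`, `|t| ≤ D` to satisfy
`σ ≤ 1 − c₂ log(c₁/((1−ρ̃)log(D(2+|t|))))/log(D(2+|t|)) ≤ 1 − c₂(2021 log 𝓛 − K)/(3𝓛) < 1 − 𝓛⁻¹`
once `log 𝓛` is large; real zeros are excluded by `ζ(σ) ≠ 0` on `(0,1)` (tree
`riemannZeta_ofReal_ne_zero_of_pos_of_lt_one`) and `σ ≥ 1` by Mathlib's non-vanishing.

Appended (same mechanism, using the slack of the repulsion): `zeta_ne_zero_of_assumptionA_logWidth`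
— under (A), `ζ(s) ≠ 0` for `Re s ≥ 1 − c₃ log 𝓛/𝓛`, `|Im s| ≤ D²` (`c₃ = 2021c₂/16`) — and
`zeta_ne_zero_of_assumptionA_width A` — for every fixed `A`, `ζ(s) ≠ 0` for `Re s ≥ 1 − A𝓛⁻¹`,
`|Im s| ≤ 2D`, `D` large — the zero-free input that size bounds for `ζ(s)⁻¹` on the contour
`σ = 1 − 𝓛⁻¹`, `|t| ≤ D` (the "standard estimates" of `Z22:§7.u049`) require.

WHAT THIS IS NOT: any claim about Theorems 1–2 of the manuscript or about Landau–Siegel zeros; not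
a discharge of `Step7u047` itself (the contour identity), only of its unstated hypothesis; the
statement is CONDITIONAL on (A) exactly as every §§5–18 node of the manuscript is.

## References

* Y. Zhang, arXiv:2211.02515v1 (2022), §7 p. 40, tex L2108–L2117; §5 Lemma 5.5 p. 28.
  [cite: Zhang2022LandauSiegel, §7 p.40]
* E. Bombieri, *Le grand crible dans la théorie analytique des nombres*, Astérisque 18 (1987), §6
  Thm. 14 (Deuring–Heilbronn phenomenon; tree `deuring_heilbronn_holds`). [cite: Bombieri1987GrandCrible, §6 Thm. 14]
-/

noncomputable section

open Complex Real

namespace Literature.NumberTheory.LFunctions.Zhang2022.Section7dStatements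

/-- For every `L₀` there is `D₀` with `𝓛 = log D ≥ max(L₀, 2)` for all `D ≥ D₀`. [folklore] -/
private theorem exists_nat_ell_ge (L₀ : ℝ) :
    ∃ D₀ : ℕ, ∀ D : ℕ, D₀ ≤ D → L₀ ≤ Skeleton.ell D ∧ 2 ≤ Skeleton.ell D := by
  refine ⟨⌈Real.exp (max L₀ 2)⌉₊, fun D hD => ?_⟩
  unfold Skeleton.ell
  have h1 : Real.exp (max L₀ 2) ≤ D := (Nat.le_ceil _).trans (by exact_mod_cast hD)
  have h2 := Real.log_le_log (Real.exp_pos _) h1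
  rw [Real.log_exp] at h2
  exact ⟨(le_max_left _ _).trans h2, (le_max_right _ _).trans h2⟩

/-- **The presupposition of the (7.19) contour move holds under (A)** (`Z22:§7.u047`/`§7.u048`,
gap-ledger row G-adj2-3): for `D` large and `χ (mod D)` real primitive with (A), `ζ(s) ≠ 0` whenever
`Re s ≥ 1 − 𝓛⁻¹` and `|Im s| ≤ D` (so `ζ(s)⁻¹` has no pole between the line `σ = 3/2` and the shifted
contour of §7 p. 40). Deuring–Heilbronn for the principal character, from Lemma 5.5's exceptional
zero. [cite: Zhang2022LandauSiegel, §7 p.40, tex L2108–L2117] -/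
theorem zeta_ne_zero_of_assumptionA :
    Skeleton.ForAllLarge fun D _ χ => Skeleton.AssumptionA D χ →
      ∀ s : ℂ, 1 - (Skeleton.ell D)⁻¹ ≤ s.re → |s.im| ≤ (D : ℝ) → riemannZeta s ≠ 0 := by
  obtain ⟨c₁, c₂, hc₁, hc₂, hDH⟩ := deuring_heilbronn_holds
  obtain ⟨C₀, D₁, h55⟩ := Skeleton.lemma55_holds
  -- constants
  obtain ⟨C, hCdef⟩ : ∃ C : ℝ, C = max C₀ 1 := ⟨_, rfl⟩
  have hC1 : 1 ≤ C := by rw [hCdef]; exact le_max_right _ _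
  have hC0 : 0 < C := by linarith
  have hC₀C : C₀ ≤ C := by rw [hCdef]; exact le_max_left _ _
  obtain ⟨K, hKdef⟩ : ∃ K : ℝ, K = Real.log (c₁ / (3 * C)) := ⟨_, rfl⟩
  obtain ⟨L₀, hL₀def⟩ : ∃ L₀ : ℝ, L₀ = Real.exp ((3 / c₂ + |K|) / 2021 + 1) := ⟨_, rfl⟩
  obtain ⟨D₂, hD₂⟩ := exists_nat_ell_ge L₀
  refine ⟨max (max D₁ D₂) 3, ?_⟩
  intro D _ χ hD hq hprim hA s hσ ht hζ
  have hD1 : D₁ ≤ D := (le_max_left _ _).trans ((le_max_left _ _).trans hD)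
  have hD2 : D₂ ≤ D := (le_max_right _ _).trans ((le_max_left _ _).trans hD)
  have hD3 : 3 ≤ D := (le_max_right _ _).trans hD
  obtain ⟨L, hLdef⟩ : ∃ L : ℝ, L = Skeleton.ell D := ⟨_, rfl⟩
  obtain ⟨hLL₀, hL2⟩ := hD₂ D hD2
  rw [← hLdef] at hLL₀ hL2 hσ
  have hL0 : 0 < L := by linarith
  have hDr : (3 : ℝ) ≤ D := by exact_mod_cast hD3
  have hD0 : (0 : ℝ) < D := by linarith
  have hLlog : L = Real.log D := by rw [hLdef]; rfl
  -- `log L` is large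
  have hlogL : (3 / c₂ + |K|) / 2021 + 1 ≤ Real.log L := by
    have h := Real.log_le_log (Real.exp_pos ((3 / c₂ + |K|) / 2021 + 1)) (hL₀def ▸ hLL₀)
    rwa [Real.log_exp] at h
  -- `σ < 1`, `s ≠ 1`, `σ > 0`
  have hσ1 : s.re < 1 := by
    by_contra h
    exact riemannZeta_ne_zero_of_one_le_re (not_lt.mp h) hζ
  have hs1 : s ≠ 1 := by
    intro h; rw [h, Complex.one_re] at hσ1; exact lt_irrefl _ hσ1
  have hLinv : L⁻¹ ≤ 1 / 2 := by
    rw [inv_eq_one_div, div_le_div_iff₀ hL0 (by norm_num : (0:ℝ) < 2)]; linarith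
  have hσ0 : 0 < s.re := by linarith
  -- the exceptional zero of Lemma 5.5 under (A)
  obtain ⟨ρt, hρt0, -, hρt1, hρtC, -⟩ := h55 D χ hD1 hq hprim hA
  rw [← hLdef] at hρtC
  have hχ1 : χ ≠ 1 := Skeleton.ne_one_of_isPrimitive_of_three_le hprim hD3
  have hρtlt : ρt < 1 := by
    rcases lt_or_eq_of_le (show ρt ≤ 1 by linarith) with h | h
    · exact h
    · exfalso
      apply DirichletCharacter.LFunction_apply_one_ne_zero hχ1
      have e : ((ρt : ℝ) : ℂ) = 1 := by rw [h]; simp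
      rw [← e]; exact hρt0
  have h1ρ : 0 < 1 - ρt := by linarith
  have h1ρC : 1 - ρt ≤ C * (L ^ 2022)⁻¹ := hρtC.trans (by gcongr)
  -- `s` is not the real zero `ρ̃` (no real zeros of `ζ` in `(0,1)`)
  have hsρ : s ≠ (ρt : ℂ) := by
    intro h
    have hre : s.re = ρt := by rw [h]; simp
    have hpos : 0 < ρt := hre ▸ hσ0
    exact riemannZeta_ofReal_ne_zero_of_pos_of_lt_one ρt hpos hρtlt (h ▸ hζ)
  -- the principal character's `L`-function vanishes at `s`
  have hLone : (1 : DirichletCharacter ℂ D).LFunction s = 0 := by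
    show DirichletCharacter.LFunctionTrivChar D s = 0
    rw [DirichletCharacter.LFunctionTrivChar_eq_mul_riemannZeta hs1, hζ, mul_zero]
  -- Deuring–Heilbronn for the principal character
  have hDHs := hDH D χ hq ρt hρtlt hρt0 1 s hLone hσ0 hσ1 hsρ
  -- the logarithms
  obtain ⟨Λ, hΛdef⟩ : ∃ Λ : ℝ, Λ = Real.log (D * (2 + |s.im|)) := ⟨_, rfl⟩
  rw [← hΛdef] at hDHs
  have h2t : 2 ≤ 2 + |s.im| := by linarith [abs_nonneg s.im]
  have hDt : (D : ℝ) ≤ D * (2 + |s.im|) := by nlinarith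
  have hΛL : L ≤ Λ := by rw [hΛdef, hLlog]; exact Real.log_le_log hD0 hDt
  have hΛ0 : 0 < Λ := by linarith
  have hΛ3 : Λ ≤ 3 * L := by
    -- D(2+|t|) ≤ D(2+D) ≤ D·D·D for D ≥ 3, so Λ ≤ 3 log D
    have h1 : D * (2 + |s.im|) ≤ (D : ℝ) ^ 3 := by
      have : 2 + |s.im| ≤ (D : ℝ) * D := by nlinarith
      calc (D : ℝ) * (2 + |s.im|) ≤ D * (D * D) := by gcongr
        _ = (D : ℝ) ^ 3 := by ring
    rw [hΛdef, hLlog]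
    calc Real.log (D * (2 + |s.im|)) ≤ Real.log ((D : ℝ) ^ 3) :=
          Real.log_le_log (by positivity) h1
      _ = 3 * Real.log D := by rw [Real.log_pow]; norm_num
  -- `(1 − ρ̃)Λ ≤ 3C/L^2021`, hence `log(c₁/((1−ρ̃)Λ)) ≥ K + 2021 log L`
  have hprod : (1 - ρt) * Λ ≤ 3 * C / L ^ 2021 := by
    calc (1 - ρt) * Λ ≤ C * (L ^ 2022)⁻¹ * (3 * L) := by gcongr
      _ = 3 * C / L ^ 2021 := by field_simp
  have hprod0 : 0 < (1 - ρt) * Λ := mul_pos h1ρ hΛ0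
  have hX : c₁ / (3 * C) * L ^ 2021 ≤ c₁ / ((1 - ρt) * Λ) := by
    rw [div_mul_eq_mul_div, div_le_div_iff₀ (by positivity) hprod0]
    calc c₁ * L ^ 2021 * ((1 - ρt) * Λ) ≤ c₁ * L ^ 2021 * (3 * C / L ^ 2021) := by gcongr
      _ = c₁ * (3 * C) := by field_simp
  have hlogX : K + 2021 * Real.log L ≤ Real.log (c₁ / ((1 - ρt) * Λ)) := by
    have hpos : 0 < c₁ / (3 * C) * L ^ 2021 := by positivity
    calc K + 2021 * Real.log L = Real.log (c₁ / (3 * C) * L ^ 2021) := by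
          rw [hKdef, Real.log_mul (by positivity) (by positivity), Real.log_pow]; norm_num
      _ ≤ Real.log (c₁ / ((1 - ρt) * Λ)) := Real.log_le_log hpos hX
  -- the repulsion beats `𝓛⁻¹`
  have hlogL1 : 1 ≤ Real.log L := by
    have : 0 ≤ (3 / c₂ + |K|) / 2021 := by positivity
    linarith
  have hnum : 3 / c₂ < K + 2021 * Real.log L := by
    have hK : -|K| ≤ K := neg_abs_le K
    have h2021 : (3 / c₂ + |K|) + 2021 ≤ 2021 * Real.log L := by
      have := mul_le_mul_of_nonneg_left hlogL (by norm_num : (0:ℝ) ≤ 2021)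
      linarith
    linarith
  have hnum0 : 0 < K + 2021 * Real.log L := lt_trans (by positivity) hnum
  have hkey : L⁻¹ < c₂ * Real.log (c₁ / ((1 - ρt) * Λ)) / Λ := by
    have h1 : c₂ * (K + 2021 * Real.log L) / (3 * L) ≤
        c₂ * Real.log (c₁ / ((1 - ρt) * Λ)) / Λ := by
      rw [div_le_div_iff₀ (by positivity) hΛ0]
      calc c₂ * (K + 2021 * Real.log L) * Λ ≤ c₂ * (K + 2021 * Real.log L) * (3 * L) := by
            gcongr
        _ = c₂ * (3 * L) * (K + 2021 * Real.log L) := by ring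
        _ ≤ c₂ * (3 * L) * Real.log (c₁ / ((1 - ρt) * Λ)) := by gcongr
        _ = c₂ * Real.log (c₁ / ((1 - ρt) * Λ)) * (3 * L) := by ring
    refine lt_of_lt_of_le ?_ h1
    rw [inv_eq_one_div, div_lt_div_iff₀ hL0 (by positivity)]
    have : 3 < c₂ * (K + 2021 * Real.log L) := by
      have := (div_lt_iff₀' hc₂).mp hnum
      linarith
    nlinarith
  -- contradiction with `σ ≥ 1 − 𝓛⁻¹`
  linarith


/-! ## Wider regions (append, theorem-only): logarithmic width `c₃·log 𝓛/𝓛` up to height `D²`,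
and any fixed width `A·𝓛⁻¹` up to height `2D`

The Deuring–Heilbronn repulsion above has slack: Lemma 5.5's exceptional zero `1 − ρ̃ ≤ C𝓛⁻²⁰²²`
pushes every other zero of `ζ` with `|t| ≤ D²` to `σ ≤ 1 − c₂(K + 2021 log 𝓛)/(4𝓛)`, a zero-free
region of width `≍ log 𝓛/𝓛`, not merely `𝓛⁻¹`. These forms are what the "standard estimates" for
`ζ(s)⁻¹` on the shifted contour of (7.19) consume (Borel–Carathéodory on discs of radius `≍ 𝓛⁻¹`
centred right of `σ = 1` needs zero-freeness on `σ ≥ 1 − A𝓛⁻¹` for a fixed `A > 1`). -/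

/-- `c·log L ≤ L/2 + c(log(2c) − 1)` for `c, L > 0` (from `log x ≤ x − 1` at `x = L/(2c)`).
[folklore] -/
private theorem mul_log_le_half_add (c L : ℝ) (hc : 0 < c) (hL : 0 < L) :
    c * Real.log L ≤ L / 2 + c * (Real.log (2 * c) - 1) := by
  have h := Real.log_le_sub_one_of_pos (show 0 < L / (2 * c) by positivity)
  rw [Real.log_div hL.ne' (by positivity)] at h
  have h2 : c * (Real.log L - Real.log (2 * c)) ≤ c * (L / (2 * c) - 1) :=
    mul_le_mul_of_nonneg_left h hc.le
  have e : c * (L / (2 * c) - 1) = L / 2 - c := by field_simp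
  rw [e] at h2
  linarith

/-- **Zero-free region of logarithmic width under (A)**: there is `c₃ > 0` such that for `D` large
and `χ (mod D)` real primitive with (A), `ζ(s) ≠ 0` whenever `Re s ≥ 1 − c₃ log 𝓛/𝓛` and
`|Im s| ≤ D²` (`c₃ = 2021c₂/16`, `c₂` the Deuring–Heilbronn constant of `deuring_heilbronn_holds`).
Same mechanism as `zeta_ne_zero_of_assumptionA`: Deuring–Heilbronn for the principal character mod
`D` from Lemma 5.5's exceptional zero, now with `log(D(2+|t|)) ≤ 4𝓛`.
[cite: Zhang2022LandauSiegel, §7 p.40, tex L2108–L2117] -/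
theorem zeta_ne_zero_of_assumptionA_logWidth :
    ∃ c₃ : ℝ, 0 < c₃ ∧ Skeleton.ForAllLarge fun D _ χ => Skeleton.AssumptionA D χ →
      ∀ s : ℂ, 1 - c₃ * Real.log (Skeleton.ell D) / Skeleton.ell D ≤ s.re →
        |s.im| ≤ (D : ℝ) ^ 2 → riemannZeta s ≠ 0 := by
  obtain ⟨c₁, c₂, hc₁, hc₂, hDH⟩ := deuring_heilbronn_holds
  obtain ⟨C₀, D₁, h55⟩ := Skeleton.lemma55_holds
  -- constants
  obtain ⟨C, hCdef⟩ : ∃ C : ℝ, C = max C₀ 1 := ⟨_, rfl⟩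
  have hC1 : 1 ≤ C := by rw [hCdef]; exact le_max_right _ _
  have hC0 : 0 < C := by linarith
  have hC₀C : C₀ ≤ C := by rw [hCdef]; exact le_max_left _ _
  obtain ⟨K, hKdef⟩ : ∃ K : ℝ, K = Real.log (c₁ / (4 * C)) := ⟨_, rfl⟩
  obtain ⟨c₃, hc₃def⟩ : ∃ c₃ : ℝ, c₃ = 2021 * c₂ / 16 := ⟨_, rfl⟩
  have hc₃ : 0 < c₃ := by rw [hc₃def]; positivity
  obtain ⟨K₂, hK₂def⟩ : ∃ K₂ : ℝ, K₂ = c₃ * (Real.log (2 * c₃) - 1) := ⟨_, rfl⟩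
  obtain ⟨L₀, hL₀def⟩ : ∃ L₀ : ℝ, L₀ = max (Real.exp (1 + 2 * |K| / 2021)) (4 * |K₂|) :=
    ⟨_, rfl⟩
  obtain ⟨D₂, hD₂⟩ := exists_nat_ell_ge L₀
  refine ⟨c₃, hc₃, max (max D₁ D₂) 3, ?_⟩
  intro D _ χ hD hq hprim hA s hσ ht hζ
  have hD1 : D₁ ≤ D := (le_max_left _ _).trans ((le_max_left _ _).trans hD)
  have hD2 : D₂ ≤ D := (le_max_right _ _).trans ((le_max_left _ _).trans hD)
  have hD3 : 3 ≤ D := (le_max_right _ _).trans hD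
  obtain ⟨L, hLdef⟩ : ∃ L : ℝ, L = Skeleton.ell D := ⟨_, rfl⟩
  obtain ⟨hLL₀, hL2⟩ := hD₂ D hD2
  rw [← hLdef] at hLL₀ hL2 hσ
  rw [hL₀def] at hLL₀
  have hL0 : 0 < L := by linarith
  have hDr : (3 : ℝ) ≤ D := by exact_mod_cast hD3
  have hD0 : (0 : ℝ) < D := by linarith
  have hLlog : L = Real.log D := by rw [hLdef]; rfl
  -- `log L` is large
  have hLexp : Real.exp (1 + 2 * |K| / 2021) ≤ L := (le_max_left _ _).trans hLL₀
  have hLK₂ : 4 * |K₂| ≤ L := (le_max_right _ _).trans hLL₀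
  have hlogL : 1 + 2 * |K| / 2021 ≤ Real.log L := by
    have h := Real.log_le_log (Real.exp_pos (1 + 2 * |K| / 2021)) hLexp
    rwa [Real.log_exp] at h
  have hK0 : 0 ≤ 2 * |K| / 2021 := by positivity
  have hlogL1 : 1 ≤ Real.log L := by linarith
  have hlogL0 : 0 < Real.log L := by linarith
  -- the width is at most `3/4`
  have hwidth : c₃ * Real.log L / L ≤ 3 / 4 := by
    have h1 := mul_log_le_half_add c₃ L hc₃ hL0
    rw [← hK₂def] at h1
    rw [div_le_iff₀ hL0]
    have : K₂ ≤ |K₂| := le_abs_self K₂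
    linarith
  -- `σ < 1`, `s ≠ 1`, `σ > 0`
  have hσ1 : s.re < 1 := by
    by_contra h
    exact riemannZeta_ne_zero_of_one_le_re (not_lt.mp h) hζ
  have hs1 : s ≠ 1 := by
    intro h; rw [h, Complex.one_re] at hσ1; exact lt_irrefl _ hσ1
  have hσ0 : 0 < s.re := by linarith
  -- the exceptional zero of Lemma 5.5 under (A)
  obtain ⟨ρt, hρt0, -, hρt1, hρtC, -⟩ := h55 D χ hD1 hq hprim hA
  rw [← hLdef] at hρtC
  have hχ1 : χ ≠ 1 := Skeleton.ne_one_of_isPrimitive_of_three_le hprim hD3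
  have hρtlt : ρt < 1 := by
    rcases lt_or_eq_of_le (show ρt ≤ 1 by linarith) with h | h
    · exact h
    · exfalso
      apply DirichletCharacter.LFunction_apply_one_ne_zero hχ1
      have e : ((ρt : ℝ) : ℂ) = 1 := by rw [h]; simp
      rw [← e]; exact hρt0
  have h1ρ : 0 < 1 - ρt := by linarith
  have h1ρC : 1 - ρt ≤ C * (L ^ 2022)⁻¹ := hρtC.trans (by gcongr)
  -- `s` is not the real zero `ρ̃` (no real zeros of `ζ` in `(0,1)`)
  have hsρ : s ≠ (ρt : ℂ) := by
    intro h
    have hre : s.re = ρt := by rw [h]; simp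
    have hpos : 0 < ρt := hre ▸ hσ0
    exact riemannZeta_ofReal_ne_zero_of_pos_of_lt_one ρt hpos hρtlt (h ▸ hζ)
  -- the principal character's `L`-function vanishes at `s`
  have hLone : (1 : DirichletCharacter ℂ D).LFunction s = 0 := by
    show DirichletCharacter.LFunctionTrivChar D s = 0
    rw [DirichletCharacter.LFunctionTrivChar_eq_mul_riemannZeta hs1, hζ, mul_zero]
  -- Deuring–Heilbronn for the principal character
  have hDHs := hDH D χ hq ρt hρtlt hρt0 1 s hLone hσ0 hσ1 hsρ
  -- the logarithms
  obtain ⟨Λ, hΛdef⟩ : ∃ Λ : ℝ, Λ = Real.log (D * (2 + |s.im|)) := ⟨_, rfl⟩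
  rw [← hΛdef] at hDHs
  have h2t : 2 ≤ 2 + |s.im| := by linarith [abs_nonneg s.im]
  have hDt : (D : ℝ) ≤ D * (2 + |s.im|) := by nlinarith
  have hΛL : L ≤ Λ := by rw [hΛdef, hLlog]; exact Real.log_le_log hD0 hDt
  have hΛ0 : 0 < Λ := by linarith
  have hΛ4 : Λ ≤ 4 * L := by
    -- `D(2+|t|) ≤ D(2+D²) ≤ D⁴` for `D ≥ 3`, so `Λ ≤ 4 log D`
    have h1 : D * (2 + |s.im|) ≤ (D : ℝ) ^ 4 := by
      have h3 : 2 + (D : ℝ) ^ 2 ≤ (D : ℝ) ^ 3 := by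
        nlinarith [mul_nonneg (mul_nonneg hD0.le hD0.le) (show (0 : ℝ) ≤ (D : ℝ) - 3 by linarith)]
      calc (D : ℝ) * (2 + |s.im|) ≤ D * (D : ℝ) ^ 3 := by gcongr; linarith
        _ = (D : ℝ) ^ 4 := by ring
    rw [hΛdef, hLlog]
    calc Real.log (D * (2 + |s.im|)) ≤ Real.log ((D : ℝ) ^ 4) :=
          Real.log_le_log (by positivity) h1
      _ = 4 * Real.log D := by rw [Real.log_pow]; norm_num
  -- `(1 − ρ̃)Λ ≤ 4C/L^2021`, hence `log(c₁/((1−ρ̃)Λ)) ≥ K + 2021 log L`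
  have hprod : (1 - ρt) * Λ ≤ 4 * C / L ^ 2021 := by
    calc (1 - ρt) * Λ ≤ C * (L ^ 2022)⁻¹ * (4 * L) := by gcongr
      _ = 4 * C / L ^ 2021 := by field_simp
  have hprod0 : 0 < (1 - ρt) * Λ := mul_pos h1ρ hΛ0
  have hX : c₁ / (4 * C) * L ^ 2021 ≤ c₁ / ((1 - ρt) * Λ) := by
    rw [div_mul_eq_mul_div, div_le_div_iff₀ (by positivity) hprod0]
    calc c₁ * L ^ 2021 * ((1 - ρt) * Λ) ≤ c₁ * L ^ 2021 * (4 * C / L ^ 2021) := by gcongr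
      _ = c₁ * (4 * C) := by field_simp
  have hlogX : K + 2021 * Real.log L ≤ Real.log (c₁ / ((1 - ρt) * Λ)) := by
    have hpos : 0 < c₁ / (4 * C) * L ^ 2021 := by positivity
    calc K + 2021 * Real.log L = Real.log (c₁ / (4 * C) * L ^ 2021) := by
          rw [hKdef, Real.log_mul (by positivity) (by positivity), Real.log_pow]; norm_num
      _ ≤ Real.log (c₁ / ((1 - ρt) * Λ)) := Real.log_le_log hpos hX
  -- `K + 2021 log L ≥ (2021/2) log L > 0`
  have hhalf : 2021 / 2 * Real.log L ≤ K + 2021 * Real.log L := by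
    have hK : -|K| ≤ K := neg_abs_le K
    have h2 : 2 * |K| ≤ 2021 * Real.log L := by
      have := (div_le_iff₀ (by norm_num : (0:ℝ) < 2021)).mp (show 2 * |K| / 2021 ≤ Real.log L by
        linarith)
      linarith
    linarith
  have hnum0 : 0 < K + 2021 * Real.log L := lt_of_lt_of_le (by positivity) hhalf
  -- the repulsion beats twice the width: `2c₃ log L / L ≤ c₂ log(c₁/((1−ρ̃)Λ))/Λ`
  have hkey : 2 * c₃ * Real.log L / L ≤ c₂ * Real.log (c₁ / ((1 - ρt) * Λ)) / Λ := by
    have h1 : c₂ * (K + 2021 * Real.log L) / (4 * L) ≤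
        c₂ * Real.log (c₁ / ((1 - ρt) * Λ)) / Λ := by
      rw [div_le_div_iff₀ (by positivity) hΛ0]
      calc c₂ * (K + 2021 * Real.log L) * Λ ≤ c₂ * (K + 2021 * Real.log L) * (4 * L) := by
            gcongr
        _ = c₂ * (4 * L) * (K + 2021 * Real.log L) := by ring
        _ ≤ c₂ * (4 * L) * Real.log (c₁ / ((1 - ρt) * Λ)) := by gcongr
        _ = c₂ * Real.log (c₁ / ((1 - ρt) * Λ)) * (4 * L) := by ring
    refine le_trans ?_ h1
    rw [div_le_div_iff₀ hL0 (by positivity)]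
    have e : 2 * c₃ * Real.log L * (4 * L) = c₂ * (2021 / 2 * Real.log L) * L := by
      rw [hc₃def]; ring
    rw [e]
    gcongr
  -- contradiction with `σ ≥ 1 − c₃ log L / L`
  have hposw : 0 < c₃ * Real.log L / L := div_pos (mul_pos hc₃ hlogL0) hL0
  have e2 : 2 * c₃ * Real.log L / L = 2 * (c₃ * Real.log L / L) := by ring
  rw [e2] at hkey
  linarith

/-- **Zero-free region of any fixed width `A·𝓛⁻¹` under (A)**: for every real `A`, for `D` large
and `χ (mod D)` real primitive with (A), `ζ(s) ≠ 0` whenever `Re s ≥ 1 − A𝓛⁻¹` and `|Im s| ≤ 2D`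
— the input of a Borel–Carathéodory bound for `ζ(s)⁻¹` on the segment `σ = 1 − 𝓛⁻¹`, `|t| ≤ D` of
the §7 contour (discs of radius `3𝓛⁻¹` about `1 + 𝓛⁻¹ + it` need `A = 2`). Corollary of
`zeta_ne_zero_of_assumptionA_logWidth` (`A ≤ c₃ log 𝓛` for `𝓛 ≥ e^{|A|/c₃}`, `2D ≤ D²`).
[cite: Zhang2022LandauSiegel, §7 p.40, tex L2108–L2126] -/
theorem zeta_ne_zero_of_assumptionA_width (A : ℝ) :
    Skeleton.ForAllLarge fun D _ χ => Skeleton.AssumptionA D χ →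
      ∀ s : ℂ, 1 - A * (Skeleton.ell D)⁻¹ ≤ s.re → |s.im| ≤ 2 * (D : ℝ) → riemannZeta s ≠ 0 := by
  obtain ⟨c₃, hc₃, D₀, h⟩ := zeta_ne_zero_of_assumptionA_logWidth
  obtain ⟨D₂, hD₂⟩ := exists_nat_ell_ge (Real.exp (|A| / c₃))
  refine ⟨max (max D₀ D₂) 2, ?_⟩
  intro D _ χ hD hq hprim hA s hσ ht
  have hD0' : D₀ ≤ D := (le_max_left _ _).trans ((le_max_left _ _).trans hD)
  have hD2' : D₂ ≤ D := (le_max_right _ _).trans ((le_max_left _ _).trans hD)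
  have hDge2 : (2 : ℝ) ≤ D := by exact_mod_cast (le_max_right _ _).trans hD
  obtain ⟨hLA, hL2⟩ := hD₂ D hD2'
  obtain ⟨L, hLdef⟩ : ∃ L : ℝ, L = Skeleton.ell D := ⟨_, rfl⟩
  rw [← hLdef] at hLA hL2 hσ
  have hL0 : 0 < L := by linarith
  have hlogL : |A| / c₃ ≤ Real.log L := by
    have h1 := Real.log_le_log (Real.exp_pos (|A| / c₃)) hLA
    rwa [Real.log_exp] at h1
  have hAc : A ≤ c₃ * Real.log L := by
    have h1 : |A| ≤ c₃ * Real.log L := by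
      rw [div_le_iff₀ hc₃] at hlogL; linarith
    exact (le_abs_self A).trans h1
  refine h D χ hD0' hq hprim hA s ?_ ?_
  · rw [← hLdef]
    have h1 : A * L⁻¹ ≤ c₃ * Real.log L / L := by
      rw [div_eq_mul_inv]
      exact mul_le_mul_of_nonneg_right hAc (inv_nonneg.mpr hL0.le)
    linarith
  · calc |s.im| ≤ 2 * D := ht
      _ ≤ (D : ℝ) * D := by nlinarith
      _ = (D : ℝ) ^ 2 := by ring

end Literature.NumberTheory.LFunctions.Zhang2022.Section7dStatements
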